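import Literature.MathematicalPhysics.QuantumManyBody.PeriodicHardCoreTube
import Literature.Analysis.FunctionSpaces.TorusHardCoreCutoff
import Literature.Analysis.FunctionSpaces.TorusNearestLatticePoint
import Mathlib.Analysis.InnerProductSpace.Calculus
import HarnessLib

/-!
# The smooth cut-off near the hard-core pair tubes, as a `C^∞` periodic symmetric function of the
# configuration

`Literature/MathematicalPhysics/QuantumManyBody` support file (everything proved; no definitions, no
named facts), namespace `Literature.MathematicalPhysics.QuantumManyBody.BoseGas`. The product cut-off
`Torus.pairCutoff θ r δ` of `TorusHardCoreCutoff` with the smooth profile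
`θ = Torus.smoothCutProfile` (`= Real.smoothTransition (· - 1)`), read on configurations through the
covering map `toUnitTorusN L : Config N → (ℝ/ℤ)^{N×3}`,

  `χ(X) = ∏_{i<j} θ((ρᵢⱼ(X/L mod ℤ) - r)/δ)`,   `ρᵢⱼ = Torus.pairDist i j`,

is the multiplier by which a smooth periodic approximant is forced to vanish near the hard cores
(`{L ρᵢⱼ ≤ a}`) while remaining an admissible `C¹` periodic Bose-symmetric trial function. This file
proves:

* `pairDist_toUnitTorusN_eq_norm_recenter` — the nearest-image distance in the cell picture is the
  recentred norm of `TorusNearestLatticePoint`: `ρᵢⱼ(toUnitTorusN L X) = ‖z - latticeVec(round z)‖`,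
  `z = (Xᵢ - Xⱼ)/L`;
* `contDiff_smoothCutProfile_norm` — `y ↦ θ((‖y‖ - r)/δ)` is `C^∞` on `ℝ³` (`0 < r + δ`: it vanishes
  on a ball around the origin, where `‖·‖` is not smooth);
* `contDiff_recenter_smoothCutProfile` — the recentred field `z ↦ θ((‖z - latticeVec(round z)‖ - r)/δ)`
  is `C^∞` when `r + 2δ < 1/2` (smooth on the balls of radius `1/2` about the lattice points by
  `Torus.contDiffOn_recenter`, identically `1` on the open set `{ρ > r + 2δ}`, and the two cover);
* `contDiff_pairCutoff_toUnitTorusN` — **`X ↦ χ(X)` is `C^∞` on `Config N`** (`0 < δ`, `0 ≤ r`,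
  `r + 2δ < 1/2`); `isTorusPeriodic_pairCutoff_toUnitTorusN` — it is `Lℤ³`-periodic in
  every particle; `pairCutoff_toUnitTorusN_eq_zero` — it vanishes where some `L ρᵢⱼ ≤ L(r + δ)`
  (Bose symmetry under permutations of the particles is `pairCutoff_toUnitTorusN_comp_perm` of
  `PeriodicHardCoreTrialProduct`, from `Torus.pairCutoff_comp_perm` of `TorusPairCutoffSymmetry`).

## Mathlib / tree search

Tree: `Torus.contDiffOn_recenter`, `Torus.latticeVec_round_eq` (`TorusNearestLatticePoint`),
`Torus.pairCutoff`, `Torus.IsCutProfile`, `Torus.contDiff_smoothCutProfile` (`TorusHardCoreCutoff`),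
`toUnitTorusN_apply`, `toUnitTorusN_add` (`PeriodicConfigFourier`); Mathlib: `contDiffAt_norm`,
`ContDiffOn.contDiffAt`, `contDiff_iff_contDiffAt`.

## References

* E. H. Lieb, R. Seiringer, J. P. Solovej, J. Yngvason, *The Mathematics of the Bose Gas and its
  Condensation*, Birkhäuser (2005), Ch. 2.
-/

noncomputable section

open MeasureTheory Filter Set WithLp UnitAddTorus Metric
open scoped ENNReal NNReal Topology ContDiff
open Literature.Analysis.FunctionSpaces

namespace Literature.MathematicalPhysics.QuantumManyBody.BoseGas

variable {N : ℕ}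

/-! ## The nearest-image distance as a recentred norm -/

/-- The recentred norm is the quotient norm: `‖z - latticeVec(round z)‖² = ∑ₖ ‖↑zₖ‖²_{ℝ/ℤ}`.
[folklore] -/
theorem norm_sub_latticeVec_round_sq (z : EuclideanSpace ℝ (Fin 3)) :
    ‖z - Torus.latticeVec fun k => round (z k)‖ ^ 2 = ∑ k : Fin 3, ‖((z k : ℝ) : UnitAddCircle)‖ ^ 2 := by
  rw [EuclideanSpace.norm_eq, Real.sq_sqrt (Finset.sum_nonneg fun _ _ => sq_nonneg _)]
  refine Finset.sum_congr rfl fun k _ => ?_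
  rw [PiLp.sub_apply, Torus.latticeVec_apply, UnitAddCircle.norm_eq, Real.norm_eq_abs, sq_abs]

/-- **The nearest-image pair distance in the cell picture is the recentred norm**:
`ρᵢⱼ(toUnitTorusN L X) = ‖z - latticeVec(round z)‖` with `z = L⁻¹ (Xᵢ - Xⱼ)`. [folklore] -/
theorem pairDist_toUnitTorusN_eq_norm_recenter (L : ℝ) (X : Config N) (i j : Fin N) :
    Torus.pairDist i j (toUnitTorusN L X) =
      ‖L⁻¹ • (X i - X j) - Torus.latticeVec fun k => round ((L⁻¹ • (X i - X j)) k)‖ := by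
  have h1 : Torus.pairDist i j (toUnitTorusN L X) ^ 2 =
      ‖L⁻¹ • (X i - X j) - Torus.latticeVec fun k => round ((L⁻¹ • (X i - X j)) k)‖ ^ 2 := by
    rw [Torus.pairDist_sq, norm_sub_latticeVec_round_sq]
    refine Finset.sum_congr rfl fun k _ => ?_
    rw [toUnitTorusN_apply, toUnitTorusN_apply, ← AddCircle.coe_sub]
    congr 3
    simp only [PiLp.smul_apply, PiLp.sub_apply, smul_eq_mul]
    ring
  rw [← Real.sqrt_sq (Torus.pairDist_nonneg i j _), h1, Real.sqrt_sq (norm_nonneg _)]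

/-! ## Smoothness of the radial profile and of its recentring -/

/-- **`y ↦ θ((‖y‖ - r)/δ)` is `C^∞` on `ℝ³`** for the smooth cut profile: it vanishes on the ball
`‖y‖ < r + δ` about the origin (`0 < r + δ`), and `‖·‖` is smooth elsewhere. [folklore] -/
theorem contDiff_smoothCutProfile_norm {r δ : ℝ} (hδ : 0 < δ) (hrδ : 0 < r + δ) {n : ℕ∞} :
    ContDiff ℝ n fun y : EuclideanSpace ℝ (Fin 3) => Torus.smoothCutProfile ((‖y‖ - r) / δ) := by
  refine contDiff_iff_contDiffAt.2 fun y => ?_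
  by_cases hy : y = 0
  · -- near the origin the function vanishes identically
    have hev : (fun w : EuclideanSpace ℝ (Fin 3) => Torus.smoothCutProfile ((‖w‖ - r) / δ)) =ᶠ[𝓝 y]
        fun _ => 0 := by
      have hball : ball (0 : EuclideanSpace ℝ (Fin 3)) (r + δ) ∈ 𝓝 y := by
        subst hy; exact ball_mem_nhds _ hrδ
      filter_upwards [hball] with w hw
      rw [mem_ball, dist_zero_right] at hw
      exact Real.smoothTransition.zero_of_nonpos (by
        show (‖w‖ - r) / δ - 1 ≤ 0
        rw [sub_nonpos, div_le_one hδ]; linarith)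
    exact (contDiffAt_const (c := (0 : ℝ))).congr_of_eventuallyEq hev
  · exact (Torus.contDiff_smoothCutProfile.contDiffAt).comp y
      (((contDiffAt_norm ℝ hy).sub contDiffAt_const).div_const δ)

/-- The recentred norm is continuous (it is the quotient norm `(∑ₖ ‖↑zₖ‖²)^{1/2}`). [folklore] -/
theorem continuous_norm_recenter :
    Continuous fun z : EuclideanSpace ℝ (Fin 3) => ‖z - Torus.latticeVec fun k => round (z k)‖ := by
  have h : (fun z : EuclideanSpace ℝ (Fin 3) => ‖z - Torus.latticeVec fun k => round (z k)‖) =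
      fun z => Real.sqrt (∑ k : Fin 3, ‖((z k : ℝ) : UnitAddCircle)‖ ^ 2) := by
    funext z
    rw [← norm_sub_latticeVec_round_sq, Real.sqrt_sq (norm_nonneg _)]
  rw [h]
  fun_prop

/-- **The recentred smooth cut-off is `C^∞`**: for `0 < δ`, `0 ≤ r`, `r + 2δ < 1/2`,
`z ↦ θ((‖z - latticeVec(round z)‖ - r)/δ)` is `C^∞` on `ℝ³` — `C^∞` on the balls of radius `1/2`
about the lattice points (`Torus.contDiffOn_recenter`), identically `1` on the open set where the
recentred norm exceeds `r + 2δ`, and every point lies in one of the two. [folklore] -/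
theorem contDiff_recenter_smoothCutProfile {r δ : ℝ} (hδ : 0 < δ) (hr : 0 ≤ r) (h2 : r + 2 * δ < 1 / 2)
    {n : ℕ∞} :
    ContDiff ℝ n fun z : EuclideanSpace ℝ (Fin 3) =>
      Torus.smoothCutProfile ((‖z - Torus.latticeVec fun k => round (z k)‖ - r) / δ) := by
  set E : EuclideanSpace ℝ (Fin 3) → ℝ := fun y => Torus.smoothCutProfile ((‖y‖ - r) / δ) with hE
  have hEs : ContDiff ℝ n E := contDiff_smoothCutProfile_norm hδ (by linarith)
  -- smooth on the balls of radius `1/2` about the lattice points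
  have hU : ContDiffOn ℝ n (fun z : EuclideanSpace ℝ (Fin 3) => E (z - Torus.latticeVec fun k => round (z k)))
      {z | ∃ k : Fin 3 → ℤ, ‖z - Torus.latticeVec k‖ < 1 / 2} :=
    Torus.contDiffOn_recenter E le_rfl hEs.contDiffOn
  have hUo : IsOpen {z : EuclideanSpace ℝ (Fin 3) | ∃ k : Fin 3 → ℤ, ‖z - Torus.latticeVec k‖ < 1 / 2} := by
    have : {z : EuclideanSpace ℝ (Fin 3) | ∃ k : Fin 3 → ℤ, ‖z - Torus.latticeVec k‖ < 1 / 2} =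
        ⋃ k : Fin 3 → ℤ, ball (Torus.latticeVec k) (1 / 2) := by
      ext z; simp [mem_ball, dist_eq_norm]
    rw [this]
    exact isOpen_iUnion fun _ => isOpen_ball
  -- the open set where the cut-off is identically `1`
  set V : Set (EuclideanSpace ℝ (Fin 3)) := {z | r + 2 * δ < ‖z - Torus.latticeVec fun k => round (z k)‖} with hV
  have hVo : IsOpen V := isOpen_lt continuous_const continuous_norm_recenter
  have hV1 : ∀ z ∈ V, E (z - Torus.latticeVec fun k => round (z k)) = 1 := fun z hz =>
    Real.smoothTransition.one_of_one_le (by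
      show (1 : ℝ) ≤ (‖z - Torus.latticeVec fun k => round (z k)‖ - r) / δ - 1
      rw [le_sub_iff_add_le, le_div_iff₀ hδ]
      have : r + 2 * δ < ‖z - Torus.latticeVec fun k => round (z k)‖ := hz
      linarith)
  refine contDiff_iff_contDiffAt.2 fun z => ?_
  by_cases hz : ‖z - Torus.latticeVec fun k => round (z k)‖ < 1 / 2
  · exact hU.contDiffAt (hUo.mem_nhds ⟨fun k => round (z k), hz⟩)
  · have hzV : z ∈ V := by
      show r + 2 * δ < ‖z - Torus.latticeVec fun k => round (z k)‖
      linarith [not_lt.1 hz]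
    have hev : (fun w : EuclideanSpace ℝ (Fin 3) => E (w - Torus.latticeVec fun k => round (w k))) =ᶠ[𝓝 z]
        fun _ => 1 := by
      filter_upwards [hVo.mem_nhds hzV] with w hw
      exact hV1 w hw
    exact (contDiffAt_const (c := (1 : ℝ))).congr_of_eventuallyEq hev

/-! ## The smooth pair cut-off on configurations -/

/-- One factor: `X ↦ θ((ρᵢⱼ(toUnitTorusN L X) - r)/δ)` is `C^∞` on `Config N` (`0 < δ`, `0 ≤ r`,
`r + 2δ < 1/2`; any real `L`). [folklore] -/
theorem contDiff_smoothCutProfile_pairDist_toUnitTorusN (L : ℝ) {r δ : ℝ} (hδ : 0 < δ)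
    (hr : 0 ≤ r) (h2 : r + 2 * δ < 1 / 2) (i j : Fin N) {n : ℕ∞} :
    ContDiff ℝ n fun X : Config N => Torus.smoothCutProfile ((Torus.pairDist i j (toUnitTorusN L X) - r) / δ) := by
  have hlin : ContDiff ℝ n fun X : Config N => L⁻¹ • (X i - X j) :=
    ((contDiff_apply ℝ Space i).sub (contDiff_apply ℝ Space j)).const_smul L⁻¹
  have h : ContDiff ℝ n ((fun z : EuclideanSpace ℝ (Fin 3) =>
      Torus.smoothCutProfile ((‖z - Torus.latticeVec fun k => round (z k)‖ - r) / δ)) ∘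
        fun X : Config N => L⁻¹ • (X i - X j)) :=
    (contDiff_recenter_smoothCutProfile hδ hr h2).comp hlin
  have hfun : (fun X : Config N => Torus.smoothCutProfile ((Torus.pairDist i j (toUnitTorusN L X) - r) / δ)) =
      ((fun z : EuclideanSpace ℝ (Fin 3) =>
        Torus.smoothCutProfile ((‖z - Torus.latticeVec fun k => round (z k)‖ - r) / δ)) ∘
          fun X : Config N => L⁻¹ • (X i - X j)) :=
    funext fun X => by simp only [Function.comp_apply, pairDist_toUnitTorusN_eq_norm_recenter]
  rw [hfun]
  exact h

/-- **The smooth pair cut-off is `C^∞` on configurations**: `X ↦ χ(X) = ∏_{i<j} θ((ρᵢⱼ(X/L mod ℤ) - r)/δ)`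
with `θ = smoothCutProfile`, for `0 < δ`, `0 ≤ r`, `r + 2δ < 1/2` (any real `L`). [folklore] -/
theorem contDiff_pairCutoff_toUnitTorusN (L : ℝ) {r δ : ℝ} (hδ : 0 < δ) (hr : 0 ≤ r)
    (h2 : r + 2 * δ < 1 / 2) {n : ℕ∞} :
    ContDiff ℝ n fun X : Config N => Torus.pairCutoff Torus.smoothCutProfile r δ (toUnitTorusN L X) := by
  unfold Torus.pairCutoff
  exact contDiff_prod fun q _ => contDiff_smoothCutProfile_pairDist_toUnitTorusN L hδ hr h2 q.1 q.2

/-- `toUnitTorusN` does not see lattice translations of one particle. [folklore] -/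
theorem toUnitTorusN_add_single_single {L : ℝ} (hL : L ≠ 0) (X : Config N) (i : Fin N) (k : Fin 3) :
    toUnitTorusN L (X + Pi.single i (EuclideanSpace.single k L)) = toUnitTorusN L X := by
  funext p
  rw [toUnitTorusN_apply, toUnitTorusN_apply, Pi.add_apply, PiLp.add_apply, add_div]
  rcases eq_or_ne p.1 i with h | h
  · rw [h, Pi.single_eq_same, PiLp.single_apply]
    split_ifs with hk
    · rw [div_self hL, AddCircle.coe_add, AddCircle.coe_period (p := (1 : ℝ)), add_zero]
    · rw [zero_div, add_zero]
  · rw [Pi.single_eq_of_ne h, PiLp.zero_apply, zero_div, add_zero]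

/-- **Periodicity**: `X ↦ χ(toUnitTorusN L X)` is `Lℤ³`-periodic in every particle (any profile).
[folklore] -/
theorem isTorusPeriodic_pairCutoff_toUnitTorusN {L : ℝ} (hL : L ≠ 0) (θ : ℝ → ℝ) (r δ : ℝ) :
    IsTorusPeriodic L fun X : Config N => Torus.pairCutoff θ r δ (toUnitTorusN L X) := by
  intro X i k
  simp only [toUnitTorusN_add_single_single hL]

/-- **The cut-off vanishes near the hard cores**: for a cut profile `θ`, `0 < δ`, if some pair `i ≠ j`
has `ρᵢⱼ(toUnitTorusN L X) ≤ r + δ` then `χ(toUnitTorusN L X) = 0`. [folklore] -/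
theorem pairCutoff_toUnitTorusN_eq_zero {K : NNReal} {θ : ℝ → ℝ} (hθ : Torus.IsCutProfile K θ) {r δ : ℝ}
    (hδ : 0 < δ) (L : ℝ) {X : Config N} {i j : Fin N} (hij : i ≠ j)
    (hX : Torus.pairDist i j (toUnitTorusN L X) ≤ r + δ) :
    Torus.pairCutoff θ r δ (toUnitTorusN L X) = 0 :=
  Torus.pairCutoff_eq_zero_of_ne hθ hδ hij hX

end Literature.MathematicalPhysics.QuantumManyBody.BoseGas

end
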